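import Summits.QuantumAdvantage.QuantumAdvantage.Theorems.SosSandwichPseudoBoundedAAClassicalCornerQuadraticLeaf
import HarnessLib

/-!
# Crux `PseudoBoundedAA` (stmt-QuantumAdvantage-15237, route SosSandwich) — the classical corner, QUADRATIC form:
# a leaf-martingale OSSS inequality for MIXTURES of decision trees, `16·Var[p]² ≤ D̄ · E_x maxⱼ (p(x) − p(xʲ))²`

Support file for the rank-2 crux PB-AA (`Theses/SosSandwich.lean`, item stmt-QuantumAdvantage-15237).  On the classical corner
`R_T ⊆ K_T` (acceptance probabilities `p = Σ_k w_k·[t_k accepts]` of randomized classical query algorithms,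
`Theorems.SosSandwich.ClassicalCorner`) the tree has the law `16·Var[p]² ≤ D̄²·maxⱼ Infⱼ[p]` (exponent pair `(2,2)`;
two-function OSSS = an `L¹`/triangle-inequality accounting along the query path, then Cauchy–Schwarz), and the repair census of
the crux (hand g8, evidence #54) asked for the true `T`-exponent of the `L²` law on `R_T` (in `[1,2]`).  This file proves the
complementary `L²` accounting — an ORTHOGONAL (martingale) decomposition of the LEAF AVERAGES of `p` along each tree — which
has the `(2,1)` shape with the maximum over coordinates INSIDE the expectation:

* `exists_leafAvg` (file `…QuadraticLeaf`) — for a tree `t` run under a partial assignment `ρ` (device of `BooleanCorner.osss_depth_aux`: already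
  assigned coordinates are answered by `ρ`, so repeated queries cost nothing), a real `g`, and any `m` dominating the squared
  increments of `g` pointwise (`(g(x^{j→1}) − g(x^{j→0}))² ≤ m(x)`), there is a function `A` (the average of `g` over the leaf
  subcube reached by `x`) with `Σ A = Σ g`, `Σ F·g = Σ F·A` for the `0/1` output `F` of `t`, and the **leaf-martingale bound**
  `Σₓ (A x − ḡ)² ≤ ¼ · depth(t) · Σₓ m x` (the variance of the conditional expectation of `g` on the leaves telescopes over the
  internal nodes into squared AVERAGED increments, each bounded by the averaged squared increment — Cauchy–Schwarz — and every
  input meets at most `depth` fresh queries); stated with `∃ A` so that no auxiliary definition enters the tree;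
* `cov_le_sqrt_depth` (file `…QuadraticLeaf`) — one tree: `2^N Σ F g − (Σ F)(Σ g) ≤ (2^N/4)·√(2^N · depth(t) · Σₓ m x)`
  (`Cov(F,g) = E[F·(A − ḡ)] ≤ ½ E|A − ḡ|` as `0 ≤ F ≤ 1` and `A − ḡ` has mean zero; then Cauchy–Schwarz);
* **`sixteen_variance_sq_le_avgDepth_mul`** — for `p = Σ_{k∈s} w_k [t_k accepts]` on the cube (`w_k ≥ 0`, `Σ w_k ≤ 1`) and EVERY
  `m` with `(p(x) − p(xʲ))² ≤ m(x)` for all `j, x`:  `16·Var[p]² ≤ D̄ · E_x m(x)`, `D̄ = Σ_k w_k depth(t_k)`; i.e.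
  `16·Var[p]² ≤ D̄ · E_x maxⱼ (p(x) − p(xʲ))²` — LINEAR in the number of queries (weighted Cauchy–Schwarz over the mixture);
  `…_weighted` keeps a general total weight `W = Σ w_k`; `…_const` is the uniform form `16·Var[p]² ≤ D̄ · maxⱼ,ₓ (p(x) − p(xʲ))²`.

Comparison and sharpness.  The tree's `(2,2)` law bounds `16 Var²` by `D̄² · maxⱼ E_x (p(x)−p(xʲ))²`, the present one by
`D̄ · E_x maxⱼ (p(x)−p(xʲ))²`: one factor `D̄` is traded for moving the maximum inside the expectation — the exchange (`E max`
versus `max E`) that separates every known influence law from the Aaronson–Ambainis conjecture itself.  The new law is an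
EQUALITY for the uniform mixture of the `N` dictators (`T = 1`; both sides `N^{-2}`) and tight up to constants for "sample `T` of
`N = KT` coordinates and output their majority" (both sides `Θ(K^{-2})`, where the `(2,2)` law is off by the factor `T`).  Hence
the `(2,1)` law `16 Var² ≤ C·D̄·maxⱼ Infⱼ` holds on every sub-family of `R_T` with `E_x maxⱼ (p(x)−p(xʲ))² ≤ C·maxⱼ E_x (p(x)−p(xʲ))²`,
and any separation of the exponents `1` and `2` on `R_T` must come from input-dependent localisation of sensitivity.

Honest label: helper inequality on a corner of an open conjecture (conditional expectations on a tree + Cauchy–Schwarz;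
folklore-strength, new to the tree); no stub, crux or summit is closed.  Sources: R. O'Donnell, M. Saks, O. Schramm, R. Servedio,
*Every decision tree has an influential variable*, FOCS 2005, Thm 3.2; H. K. Lee, ToC 6 (2010) 81–84 (induction with a partial
assignment); R. O'Donnell, *Analysis of Boolean Functions* (CUP 2014) §8.4–§8.6; S. Aaronson, A. Ambainis, arXiv:0911.0996,
Conj. 6 / Thm 8 and the remark following it.
-/

set_option linter.dupNamespace false

noncomputable section

namespace Summit.QuantumAdvantage.QuantumAdvantage.Theorems.SosSandwich

open Finset Function
open Literature.Computability.Complexity Literature.Computability.QuantumComplexity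

namespace ClassicalCornerQuadratic

variable {N : ℕ}

/-! ### Mixtures of decision trees: the quadratic law -/

/-- **Quadratic (leaf-martingale) OSSS law for MIXTURES of decision trees, general weights.** If the real polynomial `p` takes
on the cube the values `Σ_{k∈s} w_k·[t_k accepts x]` of a finite mixture of decision trees (`w_k ≥ 0`, total weight
`W = Σ_k w_k`) and `m` dominates the squared increments of `p` pointwise (`(p(x^{j→1}) − p(x^{j→0}))² ≤ m(x)` for all `j, x`), then

  `16 · Var[p]² ≤ W · D̄ · 2^{-N} Σₓ m x`,  `D̄ = Σ_k w_k · depth(t_k)`.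

Proof: `Var[p] = Σ_k w_k Cov([t_k accepts], p)`, `cov_le_sqrt_depth` for each tree, weighted Cauchy–Schwarz over the mixture.
(For `N = 0` the variance vanishes; there the hypothesis on `m` is vacuous and `0 ≤ Σ m` is assumed through `hm0`.)
[cite: OdonnellEtAl2005, Thm 3.2 (L¹ form)] [cite: AaronsonAmbainis2014, Thm 8 and the remark following it] -/
theorem sixteen_variance_sq_le_weighted {ι : Type*} (s : Finset ι) (w : ι → ℝ) (hw : ∀ k ∈ s, 0 ≤ w k)
    (t : ι → DecisionTree N) (p : MvPolynomial (Fin N) ℝ)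
    (hp : ∀ x, evalBool p x = ∑ k ∈ s, w k * (if (t k).eval x = true then (1 : ℝ) else 0))
    (m : (Fin N → Bool) → ℝ) (hm0 : ∀ x, 0 ≤ m x)
    (hm : ∀ (j : Fin N) (x : Fin N → Bool), (evalBool p (update x j true) - evalBool p (update x j false)) ^ 2 ≤ m x) :
    16 * boolVariance p ^ 2 ≤
      (∑ k ∈ s, w k) * (∑ k ∈ s, w k * ((t k).depth : ℝ)) * ((∑ x, m x) / (2 : ℝ) ^ N) := by
  -- the `0/1` outputs of the trees
  set F : ι → (Fin N → Bool) → ℝ := fun k x => if (t k).eval x = true then (1 : ℝ) else 0 with hF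
  have h2N : (0 : ℝ) < (2 : ℝ) ^ N := by positivity
  have hsm0 : 0 ≤ ∑ x, m x := Finset.sum_nonneg fun x _ => hm0 x
  -- linearity of the covariance in the first argument
  have hPg : ∑ x, evalBool p x * evalBool p x = ∑ k ∈ s, w k * ∑ x, F k x * evalBool p x := by
    calc ∑ x, evalBool p x * evalBool p x = ∑ x, ∑ k ∈ s, w k * (F k x * evalBool p x) := by
          refine Finset.sum_congr rfl fun x _ => ?_
          nth_rw 1 [hp x]
          rw [Finset.sum_mul]
          exact Finset.sum_congr rfl fun k _ => by simp only [hF]; ring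
      _ = ∑ k ∈ s, ∑ x, w k * (F k x * evalBool p x) := Finset.sum_comm
      _ = ∑ k ∈ s, w k * ∑ x, F k x * evalBool p x :=
          Finset.sum_congr rfl fun k _ => by rw [Finset.mul_sum]
  have hPs : ∑ x, evalBool p x = ∑ k ∈ s, w k * ∑ x, F k x := by
    calc ∑ x, evalBool p x = ∑ x, ∑ k ∈ s, w k * F k x := Finset.sum_congr rfl fun x _ => by rw [hp x]
      _ = ∑ k ∈ s, ∑ x, w k * F k x := Finset.sum_comm
      _ = ∑ k ∈ s, w k * ∑ x, F k x := Finset.sum_congr rfl fun k _ => by rw [Finset.mul_sum]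
  have hlin : (2 : ℝ) ^ N * (∑ x, evalBool p x * evalBool p x) - (∑ x, evalBool p x) * (∑ x, evalBool p x)
      = ∑ k ∈ s, w k * ((2 : ℝ) ^ N * (∑ x, F k x * evalBool p x) - (∑ x, F k x) * (∑ x, evalBool p x)) := by
    have e1 : (2 : ℝ) ^ N * (∑ x, evalBool p x * evalBool p x)
        = ∑ k ∈ s, w k * ((2 : ℝ) ^ N * ∑ x, F k x * evalBool p x) := by
      rw [hPg, Finset.mul_sum]
      exact Finset.sum_congr rfl fun k _ => by ring
    have e2 : (∑ x, evalBool p x) * (∑ x, evalBool p x)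
        = ∑ k ∈ s, w k * ((∑ x, F k x) * ∑ x, evalBool p x) := by
      nth_rw 1 [hPs]
      rw [Finset.sum_mul]
      exact Finset.sum_congr rfl fun k _ => by ring
    rw [e1, e2, ← Finset.sum_sub_distrib]
    exact Finset.sum_congr rfl fun k _ => by ring
  -- each tree: `cov_le_sqrt_depth`
  set S : ι → ℝ := fun k => (2 : ℝ) ^ N * ((t k).depth : ℝ) * ∑ x, m x with hS
  have hS0 : ∀ k ∈ s, 0 ≤ S k := fun k _ => mul_nonneg (mul_nonneg h2N.le (Nat.cast_nonneg _)) hsm0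
  have hterm : ∀ k ∈ s, w k * ((2 : ℝ) ^ N * (∑ x, F k x * evalBool p x) - (∑ x, F k x) * (∑ x, evalBool p x))
      ≤ w k * ((2 : ℝ) ^ N / 4 * Real.sqrt (S k)) := fun k hk =>
    mul_le_mul_of_nonneg_left (cov_le_sqrt_depth (t k) (fun _ => none) (F k) (evalBool p) m (fun x => rfl) hm) (hw k hk)
  have hsum : (2 : ℝ) ^ N * (∑ x, evalBool p x * evalBool p x) - (∑ x, evalBool p x) * (∑ x, evalBool p x)
      ≤ (2 : ℝ) ^ N / 4 * ∑ k ∈ s, w k * Real.sqrt (S k) := by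
    rw [hlin, Finset.mul_sum]
    refine Finset.sum_le_sum fun k hk => (hterm k hk).trans_eq ?_
    ring
  -- weighted Cauchy–Schwarz over the mixture
  have hcs := sum_mul_sqrt_le s w S hw hS0
  have hvar : (2 : ℝ) ^ N * (∑ x, evalBool p x * evalBool p x) - (∑ x, evalBool p x) * (∑ x, evalBool p x)
      = (2 : ℝ) ^ N * ((2 : ℝ) ^ N * boolVariance p) :=
    BooleanCorner.sum_sq_sub_sq_sum_eq p
  set W := ∑ k ∈ s, w k with hW
  set Q := ∑ k ∈ s, w k * S k with hQ
  have hW0 : 0 ≤ W := Finset.sum_nonneg hw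
  have hQ0 : 0 ≤ Q := Finset.sum_nonneg fun k hk => mul_nonneg (hw k hk) (hS0 k hk)
  have hV0 : 0 ≤ boolVariance p := boolVariance_nonneg p
  have h := (hvar.symm.le.trans hsum).trans (mul_le_mul_of_nonneg_left hcs (by positivity))
  have hmain : 4 * ((2 : ℝ) ^ N * boolVariance p) ≤ Real.sqrt W * Real.sqrt Q := by
    have h' : (2 : ℝ) ^ N * (4 * ((2 : ℝ) ^ N * boolVariance p)) ≤ (2 : ℝ) ^ N * (Real.sqrt W * Real.sqrt Q) :=
      calc (2 : ℝ) ^ N * (4 * ((2 : ℝ) ^ N * boolVariance p)) = 4 * ((2 : ℝ) ^ N * ((2 : ℝ) ^ N * boolVariance p)) := by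
            ring
        _ ≤ 4 * ((2 : ℝ) ^ N / 4 * (Real.sqrt W * Real.sqrt Q)) := mul_le_mul_of_nonneg_left h (by norm_num)
        _ = (2 : ℝ) ^ N * (Real.sqrt W * Real.sqrt Q) := by ring
    exact le_of_mul_le_mul_left h' h2N
  have hsq : (4 * ((2 : ℝ) ^ N * boolVariance p)) ^ 2 ≤ W * Q := by
    have h1 := pow_le_pow_left₀ (by positivity) hmain 2
    have hR : (Real.sqrt W * Real.sqrt Q) ^ 2 = W * Q := by
      rw [mul_pow, Real.sq_sqrt hW0, Real.sq_sqrt hQ0]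
    rwa [hR] at h1
  -- `Q = 2^N · D̄ · Σ m`
  have hQ' : Q = (2 : ℝ) ^ N * ((∑ k ∈ s, w k * ((t k).depth : ℝ)) * ∑ x, m x) := by
    rw [hQ, Finset.sum_mul, Finset.mul_sum]
    exact Finset.sum_congr rfl fun k _ => by simp only [hS]; ring
  have hfin : (16 * boolVariance p ^ 2 * (2 : ℝ) ^ N) * (2 : ℝ) ^ N
      ≤ (W * ((∑ k ∈ s, w k * ((t k).depth : ℝ)) * ∑ x, m x)) * (2 : ℝ) ^ N :=
    calc (16 * boolVariance p ^ 2 * (2 : ℝ) ^ N) * (2 : ℝ) ^ N = (4 * ((2 : ℝ) ^ N * boolVariance p)) ^ 2 := by ring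
      _ ≤ W * Q := hsq
      _ = (W * ((∑ k ∈ s, w k * ((t k).depth : ℝ)) * ∑ x, m x)) * (2 : ℝ) ^ N := by rw [hQ']; ring
  have hfin' := le_of_mul_le_mul_right hfin h2N
  rw [show W * (∑ k ∈ s, w k * ((t k).depth : ℝ)) * ((∑ x, m x) / (2 : ℝ) ^ N)
      = (W * ((∑ k ∈ s, w k * ((t k).depth : ℝ)) * ∑ x, m x)) / (2 : ℝ) ^ N by ring, le_div_iff₀ h2N]
  exact hfin'

/-- **The `(2,1)`-shaped law on the classical corner, maximum inside the expectation.** If `p` is on the cube a mixture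
`Σ_k w_k·[t_k accepts]` of decision trees with `w_k ≥ 0`, `Σ_k w_k ≤ 1` (the acceptance probability of a randomized classical
query algorithm), and `m` is ANY function dominating the squared flip-increments of `p` pointwise (`(p(x) − p(xʲ))² ≤ m(x)`
for all `j, x`; e.g. `m(x) = maxⱼ (p(x) − p(xʲ))²`), then

  `16 · Var[p]² ≤ D̄ · E_x m(x)`,  `D̄ = Σ_k w_k · depth(t_k)`

— LINEAR in the number of queries, the maximum over coordinates inside the expectation (the tree's
`ClassicalCorner.exists_influence_ge_of_mixture_sq` is `16 Var² ≤ D̄² · maxⱼ E_x (p(x) − p(xʲ))²`).  Equality for the uniform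
mixture of the `N` dictators. [cite: OdonnellEtAl2005, Thm 3.2 (L¹ form)] [cite: AaronsonAmbainis2014, Conj. 6 / Thm 8] -/
theorem sixteen_variance_sq_le_avgDepth_mul {ι : Type*} (s : Finset ι) (w : ι → ℝ) (hw : ∀ k ∈ s, 0 ≤ w k)
    (hw1 : ∑ k ∈ s, w k ≤ 1) (t : ι → DecisionTree N) (p : MvPolynomial (Fin N) ℝ)
    (hp : ∀ x, evalBool p x = ∑ k ∈ s, w k * (if (t k).eval x = true then (1 : ℝ) else 0))
    (m : (Fin N → Bool) → ℝ) (hm0 : ∀ x, 0 ≤ m x)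
    (hm : ∀ (j : Fin N) (x : Fin N → Bool), (evalBool p x - evalBool p (flipBit j x)) ^ 2 ≤ m x) :
    16 * boolVariance p ^ 2 ≤ (∑ k ∈ s, w k * ((t k).depth : ℝ)) * ((∑ x, m x) / (2 : ℝ) ^ N) := by
  have h2N : (0 : ℝ) < (2 : ℝ) ^ N := by positivity
  -- the update-increments of `p` at `x` are its flip-increments at `x`
  have hm' : ∀ (j : Fin N) (x : Fin N → Bool),
      (evalBool p (update x j true) - evalBool p (update x j false)) ^ 2 ≤ m x := by
    intro j x
    have h := ClassicalCorner.abs_update_sub_eq (evalBool p) j x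
    have : (evalBool p (update x j true) - evalBool p (update x j false)) ^ 2
        = (evalBool p x - evalBool p (flipBit j x)) ^ 2 := by
      rw [← sq_abs, h, sq_abs]
    rw [this]; exact hm j x
  have hmix := sixteen_variance_sq_le_weighted s w hw t p hp m hm0 hm'
  have hD0 : 0 ≤ ∑ k ∈ s, w k * ((t k).depth : ℝ) :=
    Finset.sum_nonneg fun k hk => mul_nonneg (hw k hk) (Nat.cast_nonneg _)
  have hX0 : 0 ≤ (∑ k ∈ s, w k * ((t k).depth : ℝ)) * ((∑ x, m x) / (2 : ℝ) ^ N) :=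
    mul_nonneg hD0 (div_nonneg (Finset.sum_nonneg fun x _ => hm0 x) h2N.le)
  calc 16 * boolVariance p ^ 2
      ≤ (∑ k ∈ s, w k) * (∑ k ∈ s, w k * ((t k).depth : ℝ)) * ((∑ x, m x) / (2 : ℝ) ^ N) := hmix
    _ = (∑ k ∈ s, w k) * ((∑ k ∈ s, w k * ((t k).depth : ℝ)) * ((∑ x, m x) / (2 : ℝ) ^ N)) := by ring
    _ ≤ 1 * ((∑ k ∈ s, w k * ((t k).depth : ℝ)) * ((∑ x, m x) / (2 : ℝ) ^ N)) :=
        mul_le_mul_of_nonneg_right hw1 hX0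
    _ = _ := one_mul _

/-- **Uniform-sensitivity form.** If every flip-increment of the mixture `p` is at most `√M` pointwise (`(p(x) − p(xʲ))² ≤ M`
for all `j, x`; e.g. `M = maxⱼ,ₓ (p(x) − p(xʲ))²`), then `16 · Var[p]² ≤ D̄ · M`.  For the uniform mixture of the `N`
dictators (`D̄ = 1`, `M = N^{-2}`, `Var = 1/(4N)`) this is an equality. [cite: OdonnellEtAl2005, Thm 3.2 (L¹ form)] -/
theorem sixteen_variance_sq_le_avgDepth_mul_const {ι : Type*} (s : Finset ι) (w : ι → ℝ) (hw : ∀ k ∈ s, 0 ≤ w k)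
    (hw1 : ∑ k ∈ s, w k ≤ 1) (t : ι → DecisionTree N) (p : MvPolynomial (Fin N) ℝ)
    (hp : ∀ x, evalBool p x = ∑ k ∈ s, w k * (if (t k).eval x = true then (1 : ℝ) else 0))
    (M : ℝ) (hM0 : 0 ≤ M) (hM : ∀ (j : Fin N) (x : Fin N → Bool), (evalBool p x - evalBool p (flipBit j x)) ^ 2 ≤ M) :
    16 * boolVariance p ^ 2 ≤ (∑ k ∈ s, w k * ((t k).depth : ℝ)) * M := by
  have h := sixteen_variance_sq_le_avgDepth_mul s w hw hw1 t p hp (fun _ => M) (fun _ => hM0) (fun j x => hM j x)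
  have hc : (∑ _x : Fin N → Bool, M) / (2 : ℝ) ^ N = M := by
    rw [Finset.sum_const, Finset.card_univ, BooleanCorner.card_cube_nat, nsmul_eq_mul]
    push_cast
    field_simp
  rwa [hc] at h

end ClassicalCornerQuadratic

end Summit.QuantumAdvantage.QuantumAdvantage.Theorems.SosSandwich
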